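import Literature.Barriers.PneNP.MatchingSlackPsdRankSmall
import HarnessLib

/-!
# A parity kernel of `K₈` needs psd rank `≥ 28` — twice the psd rank of Edmonds' slack (kernel datum for the crux's consequence)

Context. The cell's kernel theorem `parity_psdRank_of_tracialDecayExp20`
(`Summits/PneNP/PneNP/Theorems/ChebyshevTracialDesignParityPsdRank.lean`) says that the crux `TracialDecayExp20`
(stmt-PneNP-19878) forces, for EVERY sign pattern `σ : E(K_n) → {±1}`, a stretched-exponential psd rank for the
PARITY KERNEL `F_σ(U, M) = (Σ_{e ∈ M ∩ δ(U)} σ_e)² − 1` (rows: odd `U`, columns: perfect matchings `M`; nonnegative,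
vanishing on the tight pairs, design value `1`), and the cell's refuters' target (eng MEMO-12 §5.2) is ONE `σ` with a
poly-size psd factorisation of `F_σ`. This file records, for `n = 8` and the PRODUCT pattern `σ(ij) = s_i s_j`, `s = −1` on
`{0,1,2}` (so `Σ σ = |δ(S△U) ∩ M| − |δ(S) ∩ M|` with `S = {0,1,2}`), that

  `F_σ` has a triangular `28`-pattern, hence `¬ HasPsdFactorization F_σ 27` (`not_hasPsdFactorization_parityKernel3_27`),

while the slack matrix itself HAS a psd factorisation of size `14` (`PsdRankSmall.hasPsdFactorization_pmOddCutSlack_eight`):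
at `n = 8` this parity kernel is provably HARDER than the slack by a factor `≥ 2` (`parityKernel3_harder_than_slack`). The
`28` is the exact maximum of the triangular bound for this `σ` (cell engineering memo MEMO-28 §3, exhaustive search; random sign
patterns also give `28`; at `n = 10` the triangular bounds are `113–117` against `Catalan(5) = 42`). The bound is
[FawziEtAl2015, Thm. 2.10 + Ex. 2.11 (p07)] (tree: `HasPsdFactorization.card_le_of_triangular`) on an explicit pattern,
decided by the kernel on the INTEGER form of the kernel (`parityKernel3_eq_cast`).

Honest limits: a small-`n` datum only — the triangular bound of any `F_σ` is at most `rank F_σ ≤ 1 + C(n,2) + 3·C(n,4)`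
(the columns are degree-`4` polynomials in the `±1` indicator of `U`), so nothing here is asymptotic; it says only that the
refuters' cheapest family shows no small-`n` weakness. Label: instrument. WHAT THIS IS NOT: no statement about the crux,
no P-vs-NP content.
-/

noncomputable section

open Finset

namespace Literature.Barriers.PneNP

open Literature.Combinatorics.Optimization (HasPsdFactorization)
open Literature.Combinatorics.SimpleGraph.CycleSpace (Crosses)

namespace ParityKernelEight

/-- The vertex signs `s = −1` on `{0,1,2}`, `+1` elsewhere (as integers). [cite: FawziEtAl2015, §5.2 (p15)] -/
def sgn3 (i : Fin 8) : ℤ := if i.val < 3 then -1 else 1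

/-- The product sign pattern on edges, integer form: `σ(ij) = s_i s_j`. [cite: FawziEtAl2015, §5.2 (p15)] -/
def sigma3Z : Sym2 (Fin 8) → ℤ :=
  Sym2.lift ⟨fun i j => sgn3 i * sgn3 j, fun _ _ => mul_comm _ _⟩

/-- The product sign pattern on edges, real form. [cite: FawziEtAl2015, §5.2 (p15)] -/
def sigma3 (e : Sym2 (Fin 8)) : ℝ := (sigma3Z e : ℝ)

/-- `σ` takes values `±1`. [cite: FawziEtAl2015, §5.2 (p15)] -/
theorem sigma3_sign : ∀ e : Sym2 (Fin 8), sigma3 e = 1 ∨ sigma3 e = -1 := by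
  intro e
  have h : ∀ e : Sym2 (Fin 8), sigma3Z e = 1 ∨ sigma3Z e = -1 := by decide
  rcases h e with h1 | h1
  · left; simp [sigma3, h1]
  · right; simp [sigma3, h1]

/-- **The parity kernel** `F_σ(U, M) = (Σ_{e ∈ M, e crosses U} σ_e)² − 1` for the product pattern `σ` of `S = {0,1,2}` at `n = 8`
(the matrix of `parity_psdRank_of_tracialDecayExp20`, instantiated). [cite: FawziEtAl2015, §5.2 (p15)] -/
def parityKernel3 (U : OddSet 8) (M : PMatch 8) : ℝ :=
  (∑ e ∈ M.1.filter (Crosses U.1), sigma3 e) ^ 2 - 1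

/-- Integer form of the kernel. [cite: FawziEtAl2015, §5.2 (p15)] -/
def parityKernel3Z (U : OddSet 8) (M : PMatch 8) : ℤ :=
  (∑ e ∈ M.1.filter (Crosses U.1), sigma3Z e) ^ 2 - 1

/-- The real kernel is the cast of the integer kernel. [cite: FawziEtAl2015, §5.2 (p15)] -/
theorem parityKernel3_eq_cast (U : OddSet 8) (M : PMatch 8) :
    parityKernel3 U M = (parityKernel3Z U M : ℝ) := by
  simp [parityKernel3, parityKernel3Z, sigma3, Int.cast_sum]

/-- Rows of the triangular `28`-pattern (all `3`-sets). [cite: FawziEtAl2015, Thm. 2.10 + Ex. 2.11 (p07)] -/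
def ρ28 : Fin 28 → OddSet 8 :=
  ![⟨{0, 2, 3}, by decide⟩, ⟨{3, 5, 7}, by decide⟩, ⟨{3, 4, 7}, by decide⟩, ⟨{1, 2, 6}, by decide⟩,
    ⟨{1, 2, 4}, by decide⟩, ⟨{0, 1, 3}, by decide⟩, ⟨{0, 3, 4}, by decide⟩, ⟨{0, 3, 7}, by decide⟩,
    ⟨{3, 6, 7}, by decide⟩, ⟨{1, 4, 6}, by decide⟩, ⟨{0, 3, 5}, by decide⟩, ⟨{0, 5, 7}, by decide⟩,
    ⟨{1, 3, 7}, by decide⟩, ⟨{4, 5, 6}, by decide⟩, ⟨{0, 2, 7}, by decide⟩, ⟨{0, 4, 7}, by decide⟩,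
    ⟨{0, 1, 7}, by decide⟩, ⟨{1, 4, 5}, by decide⟩, ⟨{4, 6, 7}, by decide⟩, ⟨{1, 4, 7}, by decide⟩,
    ⟨{1, 6, 7}, by decide⟩, ⟨{2, 6, 7}, by decide⟩, ⟨{1, 2, 7}, by decide⟩, ⟨{0, 1, 6}, by decide⟩,
    ⟨{0, 2, 4}, by decide⟩, ⟨{0, 4, 6}, by decide⟩, ⟨{0, 1, 5}, by decide⟩, ⟨{0, 1, 2}, by decide⟩]

/-- Columns of the triangular `28`-pattern. [cite: FawziEtAl2015, Thm. 2.10 + Ex. 2.11 (p07)] -/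
def γ28 : Fin 28 → PMatch 8 :=
  ![⟨{s(0, 7), s(1, 3), s(2, 4), s(5, 6)}, by decide⟩, ⟨{s(0, 7), s(1, 5), s(2, 3), s(4, 6)}, by decide⟩,
    ⟨{s(0, 3), s(1, 7), s(2, 4), s(5, 6)}, by decide⟩, ⟨{s(0, 6), s(1, 5), s(2, 7), s(3, 4)}, by decide⟩,
    ⟨{s(0, 4), s(1, 7), s(2, 5), s(3, 6)}, by decide⟩, ⟨{s(0, 5), s(1, 6), s(2, 3), s(4, 7)}, by decide⟩,
    ⟨{s(0, 1), s(2, 7), s(3, 5), s(4, 6)}, by decide⟩, ⟨{s(0, 2), s(1, 6), s(3, 4), s(5, 7)}, by decide⟩,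
    ⟨{s(0, 3), s(1, 6), s(2, 7), s(4, 5)}, by decide⟩, ⟨{s(0, 5), s(1, 2), s(3, 6), s(4, 7)}, by decide⟩,
    ⟨{s(0, 1), s(2, 4), s(3, 7), s(5, 6)}, by decide⟩, ⟨{s(0, 2), s(1, 3), s(4, 5), s(6, 7)}, by decide⟩,
    ⟨{s(0, 4), s(1, 2), s(3, 6), s(5, 7)}, by decide⟩, ⟨{s(0, 5), s(1, 4), s(2, 6), s(3, 7)}, by decide⟩,
    ⟨{s(0, 5), s(1, 7), s(2, 4), s(3, 6)}, by decide⟩, ⟨{s(0, 1), s(2, 3), s(4, 6), s(5, 7)}, by decide⟩,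
    ⟨{s(0, 5), s(1, 6), s(2, 7), s(3, 4)}, by decide⟩, ⟨{s(0, 3), s(1, 2), s(4, 6), s(5, 7)}, by decide⟩,
    ⟨{s(0, 7), s(1, 4), s(2, 6), s(3, 5)}, by decide⟩, ⟨{s(0, 7), s(1, 5), s(2, 4), s(3, 6)}, by decide⟩,
    ⟨{s(0, 4), s(1, 2), s(3, 7), s(5, 6)}, by decide⟩, ⟨{s(0, 7), s(1, 6), s(2, 5), s(3, 4)}, by decide⟩,
    ⟨{s(0, 7), s(1, 4), s(2, 5), s(3, 6)}, by decide⟩, ⟨{s(0, 3), s(1, 5), s(2, 6), s(4, 7)}, by decide⟩,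
    ⟨{s(0, 3), s(1, 4), s(2, 5), s(6, 7)}, by decide⟩, ⟨{s(0, 3), s(1, 6), s(2, 4), s(5, 7)}, by decide⟩,
    ⟨{s(0, 3), s(1, 6), s(2, 5), s(4, 7)}, by decide⟩, ⟨{s(0, 3), s(1, 5), s(2, 4), s(6, 7)}, by decide⟩]

set_option maxHeartbeats 800000 in
/-- The pattern is triangular for the INTEGER kernel (kernel `decide`): nonzero diagonal, zero above.
[cite: FawziEtAl2015, Thm. 2.10 + Ex. 2.11 (p07)] -/
theorem pattern28_int :
    (∀ a, parityKernel3Z (ρ28 a) (γ28 a) ≠ 0) ∧ ∀ a b : Fin 28, a < b → parityKernel3Z (ρ28 a) (γ28 b) = 0 := by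
  refine ⟨by decide +kernel, by decide +kernel⟩

/-- **`rk_psd(F_σ) ≥ 28` at `n = 8`** for the product pattern of `{0,1,2}`: no psd factorisation of size `27`.
[cite: FawziEtAl2015, Thm. 2.10 + Ex. 2.11 (p07)] -/
theorem not_hasPsdFactorization_parityKernel3_27 : ¬ HasPsdFactorization parityKernel3 27 := by
  intro h
  obtain ⟨hd, ho⟩ := pattern28_int
  have h28 : 28 ≤ 27 := h.card_le_of_triangular ρ28 γ28
    (fun a h0 => hd a (by rw [parityKernel3_eq_cast] at h0; exact_mod_cast h0))
    (fun a b hab => by rw [parityKernel3_eq_cast, ho a b hab]; simp)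
  omega

/-- `rk_psd(F_σ) ≥ 28` in the `≤`-form. [cite: FawziEtAl2015, Thm. 2.10 + Ex. 2.11 (p07)] -/
theorem twentyeight_le_of_hasPsdFactorization_parityKernel3 {r : ℕ} (h : HasPsdFactorization parityKernel3 r) : 28 ≤ r := by
  by_contra hlt
  exact not_hasPsdFactorization_parityKernel3_27 (h.mono (by omega))

end ParityKernelEight

open ParityKernelEight in
/-- **At `n = 8` the parity kernel is at least twice as hard as the slack**: Edmonds' odd-cut slack matrix of `K₈` has a psd
factorisation of size `14` (the exact `S₈`-equivariant one, companion file), whereas the parity kernel of the product sign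
pattern of `{0,1,2}` — which, like the slack, is nonnegative, vanishes on the tight pairs and has design value `1`
(`ChebyshevTracialDesignParityKernel`) — has none of size `< 28`.
[cite: FawziEtAl2015, Thm. 2.10 + Ex. 2.11 (p07); Thm. 2.9 (v) (p06–p07)] -/
theorem parityKernel3_harder_than_slack :
    HasPsdFactorization (pmOddCutSlack 8) 14 ∧ ∀ r, HasPsdFactorization parityKernel3 r → 28 ≤ r :=
  ⟨PsdRankSmall.hasPsdFactorization_pmOddCutSlack_eight, fun _ h => twentyeight_le_of_hasPsdFactorization_parityKernel3 h⟩

end Literature.Barriers.PneNP
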